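import Summits.BirchSwinnertonDyer.BirchSwinnertonDyer.Theorems.TwoAdicConverseBDPSelmerLowerDivisibilityAtTwoTowerLineControl
import Summits.BirchSwinnertonDyer.BirchSwinnertonDyer.Theorems.TwoAdicConverseOrdLambdaHalfAtTwoBDPTwoVariableDefs
import Literature.NumberTheory.FaltingsSerre.ParamodularCertificate
import Literature.NumberTheory.EllipticCurves.KellerYin2024.CharacterSelmerGroups
import HarnessLib

/-!
# Crux O2 `BDPSelmerLowerDivisibilityAtTwo` (stmt-BirchSwinnertonDyer-24728) — line `split_prime_line_finite_two`
# (crux-ideate seat 2, gen 6; lens `solvent`@stub: GL(1)-dévissage × `stub_lineFinite` × the v-RAMIFIED ℤ₂-line)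

Nothing here is proved about any elliptic curve's `L`-function; O2 / 19556 / 19218 stay OPEN; BSD is proved for no
curve; typed ≠ proved.  This file RE-TYPES ONE registered stub of the line of record v6
(`TwoVariableGvSqueezeTwo.stub_lineFinite : TwoVariableLineSelmerFiniteAtTwo`, lead cruxlead-19556 g12, sha16
263ad7b9dbf4ab41) — FINLINE₂ = «Greenberg's BDP-type Selmer group of `E[2^∞]` over the `κ₂`-line, strict above `v̄`,
relaxed above `v`, has finite 2-torsion», demanded at EVERY adapted pair — into the three pieces the v6 node actually
needs it for (the lead's own CAVEAT: the node consumes FINLINE₂ only to get the PAIR-INDEPENDENT facts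
`Module.IsTorsion Λ_K X_Gr₂` and `red ch(X_Gr₂) ≠ 0`):

* `SplitPrimeLineSelmerFiniteAt W K`   — FINLINE only at pairs whose line `κ₂` is RAMIFIED ONLY AT `v` (the prime of `K`
  above 2 at which the BDP condition is relaxed): the ℤ₂-extension `K_∞^{(v)} ⊂ K(v^∞)`;
* `SplitPrimePairExistsAt K`          — such adapted pairs exist (class field theory; GL(1));
* `TorsionResidueTransportAt W K`     — torsion and residual non-vanishing of `ch` pass between adapted pairs of the same
  `K̃_∞` and the same strict prime `v̄` (the lead's PAIR-TRANSPORT₂, tower-1 word W1; kernel);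

with the KERNEL-CHECKED seam `torsionResidueForall_of_splitLine` (§3) landing exactly the two per-pair consequences v6
derives from `stub_lineFinite` through the tree doors
`TwoAdicBDPTowerLineControl.xGr₂_baseChange_two_isTorsion_of_lineFinite` /
`…xGr₂_baseChange_two_map_residue_toUnr₂_ne_zero_of_lineFinite` (p769393).  The point of the re-typing (§4): on the
v-ramified line — and, as far as print goes at `p = 2`, ONLY there — FINLINE is reducible to GL(1) PRINT:

* `TrivialCharSplitLineFiniteAt K`    — the same BDP-type Selmer set for the TRIVIAL character `ℚ₂/ℤ₂`
  (`KellerYin2024.charModule ∅ 1`) over `K_∞^{(v)}`, relaxed at any finite `S₀`, has finite 2-torsion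
  ⟸ Oukhaba–Viguié 2016 Thm 1.2 («µ = 0 for all p» for `X_∞ = Gal(M_∞/K_∞^{(𝔭)})`, arXiv:1311.3565 p. 1–2) +
  Greenberg 1978 (`X_∞` is `Λ`-torsion) + tame inertia at `S₀` — PRINT at `p = 2`, GL(1);
* `EisensteinDevissageAt W K`         — on habitat (β) (`E[2]` reducible = a rational 2-torsion point) the exact sequence
  `0 → 𝟙 → E[2] → 𝟙 → 0` bounds FINLINE(κ₂) by the trivial-character set twice (Sel_{∅,0} has NO curve-dependent
  local condition above 2, so the dévissage is clean) — kernel Galois cohomology, first brick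
  `finite_of_finite_image_of_finite_inter_ker` proved in §4.

On the anticyclotomic line the same dévissage needs the anticyclotomic GL(1) `µ = 0` at 2 (Hida / Burungale–Hsieh need
`p > 2`; asked as open for `p = 2` by Oukhaba–Viguié, p. 2) — which is why the LINE is the lever.
-/

open scoped Classical

namespace Summit.BirchSwinnertonDyer.BirchSwinnertonDyer.Cruxes.BDPSelmerLowerDivisibilityAtTwo.SplitPrimeLineFiniteTwo

open NumberField IsDedekindDomain Literature.NumberTheory.EllipticCurves PowerSeries
  Literature.NumberTheory.EllipticCurves.GreenbergSelmer Literature.NumberTheory.EllipticCurves.GreenbergVatsal2000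
  Literature.NumberTheory.EllipticCurves.Castella2018
  Literature.NumberTheory.GaloisRepresentations
  Summit.BirchSwinnertonDyer.BirchSwinnertonDyer.Theorems.TwoAdicBDPTowerLineControl

/-! ## §1 The v-ramified line -/

/-- `κ` is RAMIFIED ONLY INSIDE `S`: every inertia group of `Γ_K` at a finite place outside `S` lies in `ker κ`
(for `S = {v}`, `K` imaginary quadratic, `2 = v v̄`: `K̄^{ker κ}` is the ℤ₂-extension `K_∞^{(v)} ⊂ K(v^∞)`). -/
def RamifiedOnlyIn {K : Type} [Field K] [NumberField K] {p : ℕ} [Fact p.Prime] (κ : ZpExtension K p)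
    (S : Set (HeightOneSpectrum (𝓞 K))) : Prop :=
  Literature.NumberTheory.FaltingsSerre.inertiaOutside K S ⊆
    ((κ.kerSubgroup : Subgroup (Field.absoluteGaloisGroup K)) : Set (Field.absoluteGaloisGroup K))

/-- FIN-LINE(κ₂; v̄) — VERBATIM the registered stub's datum (the type of the door's `hline`): the 2-torsion of
Greenberg's Selmer group of `E[2^∞]` over `K̄^{ker κ₂}`, strict above `v̄`, relaxed at the other prime above 2,
`S₀ = ∅`, is finite.  Depends on `(κ₂, v̄)` only. -/
def LineSelmerTwoTorsionFinite (W : WeierstrassCurve ℚ) [W.IsElliptic] (K : Type) [Field K] [NumberField K]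
    (κ₂ : ZpExtension K 2) (vbar : HeightOneSpectrum (𝓞 K)) : Prop :=
  Set.Finite {t : (W.baseChange K).subgroupH1 2 κ₂.kerSubgroup |
    t ∈ datumSelmerInfty κ₂ ((W.baseChange K).geomPrimaryTorsion 2)
      (AcSelmer.bdpData ((W.baseChange K).geomPrimaryTorsion 2) 2 vbar) ∅ ∧ 2 • t = 0}

/-- **FIN-SPLIT** (piece P1, UNDECIDED → reduced to PRINT ∧ kernel by §4): FIN-LINE at every line `κ₂` ramified only at
the relaxed prime `v`. -/
def SplitPrimeLineSelmerFiniteAt (W : WeierstrassCurve ℚ) [W.IsElliptic] (K : Type) [Field K] [NumberField K] :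
    Prop :=
  IsImaginaryQuadratic K → ∀ (v vbar : HeightOneSpectrum (𝓞 K)) (κ₂ : ZpExtension K 2), ((2 : ℕ) : 𝓞 K) ∈ v.asIdeal →
    ((2 : ℕ) : 𝓞 K) ∈ vbar.asIdeal → vbar ≠ v → RamifiedOnlyIn κ₂ {v} → LineSelmerTwoTorsionFinite W K κ₂ vbar

/-- **SPLIT-PAIR-EXISTS** (piece P2, ATTACKABLE, GL(1)/CFT): for `2 = v v̄` split in `K` there is an adapted pair
`(κ₁, κ₂; γ₁, γ₂)` whose second line is ramified only at `v` (e.g. `κ₁ = κ_{v̄}`, `κ₂ = κ_v`: the two split-prime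
ℤ₂-extensions are independent mod 2, being ramified at different primes). -/
def SplitPrimePairExistsAt (K : Type) [Field K] [NumberField K] : Prop :=
  IsImaginaryQuadratic K → ∀ (v vbar : HeightOneSpectrum (𝓞 K)), ((2 : ℕ) : 𝓞 K) ∈ v.asIdeal → ((2 : ℕ) : 𝓞 K) ∈ vbar.asIdeal → vbar ≠ v →
    ∃ (κ₁ κ₂ : ZpExtension K 2) (γ₁ γ₂ : Field.absoluteGaloisGroup K),
      ZpExtension.IsTopGeneratorPair κ₁ κ₂ γ₁ γ₂ ∧ RamifiedOnlyIn κ₂ {v}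

/-! ## §2 What v6 consumes per pair, and its transport between pairs -/

/-- The residual non-vanishing of a generator `C₀` of `ch_{Λ_K}(X_Gr₂)` along `J : ℤ₂ → 𝒪_{ℂ₂}` (v6's `μ₂ = 0` clause). -/
def ResidueNonvanishing (J : ℤ_[2] →+* PadicComplexInt 2) (C₀ : IwasawaAlgebra₂ 2) : Prop :=
  PowerSeries.map (PowerSeries.map (IsLocalRing.residue (PadicComplexInt 2))) (IwasawaAlgebra₂.toUnr₂ 2 J C₀) ≠ 0

/-- **TORSION ∧ RESIDUE at every adapted pair** — exactly the two consequences the v6 node draws from `stub_lineFinite`. -/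
def TorsionResidueForallAt (W : WeierstrassCurve ℚ) [W.IsElliptic] (K : Type) [Field K] [NumberField K] : Prop :=
  IsImaginaryQuadratic K → ∀ (v vbar : HeightOneSpectrum (𝓞 K)), ((2 : ℕ) : 𝓞 K) ∈ v.asIdeal → ((2 : ℕ) : 𝓞 K) ∈ vbar.asIdeal → vbar ≠ v →
    ∀ (κ₁ κ₂ : ZpExtension K 2) (γ₁ γ₂ : Field.absoluteGaloisGroup K)
      [Fact (ZpExtension.IsTopGeneratorPair κ₁ κ₂ γ₁ γ₂)],
      Module.IsTorsion (IwasawaAlgebra₂ 2) ((W.baseChange K).XGr₂ 2 κ₁ κ₂ vbar γ₁ γ₂) ∧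
        ∀ (J : ℤ_[2] →+* PadicComplexInt 2) (C₀ : IwasawaAlgebra₂ 2),
          WeierstrassCurve.XGr₂.charIdeal (W.baseChange K) 2 κ₁ κ₂ vbar γ₁ γ₂ = Ideal.span {C₀} →
            ResidueNonvanishing J C₀

/-- **PAIR-TRANSPORT₂** (piece P3, ATTACKABLE kernel; the lead's W1): torsion of `X_Gr₂` and residual non-vanishing of
its characteristic generators pass from one adapted pair `(κ₁', κ₂'; γ₁', γ₂')` to any other `(κ₁, κ₂; γ₁, γ₂)` at the
same strict prime `v̄` (same underlying `ℤ₂⟦Gal(K̃_∞/K)⟧`-module; only the `Λ_K`-coordinates change). -/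
def TorsionResidueTransportAt (W : WeierstrassCurve ℚ) [W.IsElliptic] (K : Type) [Field K] [NumberField K] : Prop :=
  IsImaginaryQuadratic K → ∀ (vbar : HeightOneSpectrum (𝓞 K)), ((2 : ℕ) : 𝓞 K) ∈ vbar.asIdeal →
    ∀ (κ₁ κ₂ κ₁' κ₂' : ZpExtension K 2) (γ₁ γ₂ γ₁' γ₂' : Field.absoluteGaloisGroup K)
      [Fact (ZpExtension.IsTopGeneratorPair κ₁ κ₂ γ₁ γ₂)] [Fact (ZpExtension.IsTopGeneratorPair κ₁' κ₂' γ₁' γ₂')],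
      (Module.IsTorsion (IwasawaAlgebra₂ 2) ((W.baseChange K).XGr₂ 2 κ₁' κ₂' vbar γ₁' γ₂') →
          Module.IsTorsion (IwasawaAlgebra₂ 2) ((W.baseChange K).XGr₂ 2 κ₁ κ₂ vbar γ₁ γ₂)) ∧
        ((∀ (J : ℤ_[2] →+* PadicComplexInt 2) (C₀ : IwasawaAlgebra₂ 2),
            WeierstrassCurve.XGr₂.charIdeal (W.baseChange K) 2 κ₁' κ₂' vbar γ₁' γ₂' = Ideal.span {C₀} →
              ResidueNonvanishing J C₀) →
          ∀ (J : ℤ_[2] →+* PadicComplexInt 2) (C₀ : IwasawaAlgebra₂ 2),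
            WeierstrassCurve.XGr₂.charIdeal (W.baseChange K) 2 κ₁ κ₂ vbar γ₁ γ₂ = Ideal.span {C₀} →
              ResidueNonvanishing J C₀)

/-! ## §3 The node seam (kernel): FIN-SPLIT ∧ SPLIT-PAIR-EXISTS ∧ PAIR-TRANSPORT₂ ⟹ TORSION ∧ RESIDUE at every pair -/

/-- **Node seam.**  For `K` imaginary quadratic: finiteness on the v-ramified lines, existence of a split adapted pair
and pair transport give, at EVERY adapted pair, the torsion of `X_Gr((E_K)/K̃_∞)` and the residual non-vanishing of
its characteristic generators — through the tree doors of `TwoAdicBDPTowerLineControl` (tower-1 GEN 47). -/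
theorem torsionResidueForall_of_splitLine (W : WeierstrassCurve ℚ) [W.IsElliptic] (K : Type) [Field K]
    [NumberField K] (hK : IsImaginaryQuadratic K) (hfin : SplitPrimeLineSelmerFiniteAt W K)
    (hex : SplitPrimePairExistsAt K) (htr : TorsionResidueTransportAt W K) : TorsionResidueForallAt W K := by
  intro _ v vbar hv hvbar hne κ₁ κ₂ γ₁ γ₂ _
  obtain ⟨κ₁', κ₂', γ₁', γ₂', hpair', hram⟩ := hex hK v vbar hv hvbar hne
  haveI : Fact (ZpExtension.IsTopGeneratorPair κ₁' κ₂' γ₁' γ₂') := ⟨hpair'⟩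
  have hline : LineSelmerTwoTorsionFinite W K κ₂' vbar := hfin hK v vbar κ₂' hv hvbar hne hram
  obtain ⟨htor, hres⟩ := htr hK vbar hvbar κ₁ κ₂ κ₁' κ₂' γ₁ γ₂ γ₁' γ₂'
  refine ⟨htor (xGr₂_baseChange_two_isTorsion_of_lineFinite W K hK κ₁' κ₂' vbar hvbar γ₁' γ₂' hline), ?_⟩
  exact hres fun J C₀ hC ↦
    xGr₂_baseChange_two_map_residue_toUnr₂_ne_zero_of_lineFinite W K hK κ₁' κ₂' vbar hvbar γ₁' γ₂' hline J hC

/-! ## §4 Why FIN-SPLIT is print-reducible at 2: the trivial character over the v-ramified line, and the dévissage -/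

/-- The TRIVIAL GL₁ character module `ℚ₂/ℤ₂` of `Γ_K`, as the Keller–Yin carrier `(F/𝒪)(θ)` at `θ = 1`, `S = ∅`. -/
abbrev TrivCharModule (K : Type) [Field K] [NumberField K] : Type :=
  KellerYin2024.charModule (∅ : Set (PadicAlgCl 2))
    (1 : FramedGaloisRep K (padicCoeffIntegers (∅ : Set (PadicAlgCl 2))) 1)

/-- **GL1-FIN** (piece P4, PRINT + elementary): over every line `κ` ramified only at `v`, the BDP-type Selmer set of the
trivial character (strict = locally split above `v̄`, relaxed above `v`, relaxed at a finite `S₀`) has finite 2-torsion —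
`Hom(𝔛, ℚ₂/ℤ₂)[2]` for a quotient `𝔛` of `Gal(M^{S₀ ∪ {v}}_∞/K_∞^{(v)})`, finitely generated over `ℤ₂` by
Oukhaba–Viguié 2016 Thm 1.2 (µ = 0, all `p`) + Greenberg 1978 (Λ-torsion) + pro-2 tame inertia at the finitely many
places above `S₀`. [cite: arXiv:1311.3565, Thm 1.2] -/
def TrivialCharSplitLineFiniteAt (K : Type) [Field K] [NumberField K] : Prop :=
  IsImaginaryQuadratic K → ∀ (v vbar : HeightOneSpectrum (𝓞 K)) (κ : ZpExtension K 2) (S₀ : Set (HeightOneSpectrum (𝓞 K))), S₀.Finite →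
    ((2 : ℕ) : 𝓞 K) ∈ v.asIdeal → ((2 : ℕ) : 𝓞 K) ∈ vbar.asIdeal → vbar ≠ v → RamifiedOnlyIn κ {v} →
    Set.Finite {t : subgroupH1 κ.kerSubgroup (TrivCharModule K) |
      t ∈ datumSelmerInfty κ (TrivCharModule K) (AcSelmer.bdpData (TrivCharModule K) 2 vbar) S₀ ∧ 2 • t = 0}

/-- **DEV** (piece P5, ATTACKABLE kernel Galois cohomology): on habitat (β) — `E[2]` reducible, i.e. a rational point of
order 2, so `0 → 𝟙 → E[2] → 𝟙 → 0` over `ℚ` — GL1-FIN bounds FIN-LINE on every v-ramified line (take `S₀` = the bad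
places; the conditions above 2 are relaxed/strict, hence curve-independent; kernel bricks: the long exact sequence,
`E(K_∞^{(v)})[2^∞]` finite, finitely many places above `v̄` and `S₀` on the line, and
`finite_of_finite_image_of_finite_inter_ker` below). -/
def EisensteinDevissageAt (W : WeierstrassCurve ℚ) [W.IsElliptic] (K : Type) [Field K] [NumberField K] : Prop :=
  ¬ W.HasIrreducibleModPGaloisRep 2 → TrivialCharSplitLineFiniteAt K → SplitPrimeLineSelmerFiniteAt W K

/-- Sub-node seam (modus ponens; the content is in DEV and GL1-FIN). -/
theorem splitPrimeLineSelmerFinite_of_devissage (W : WeierstrassCurve ℚ) [W.IsElliptic] (K : Type) [Field K]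
    [NumberField K] (hdev : EisensteinDevissageAt W K) (hred : ¬ W.HasIrreducibleModPGaloisRep 2)
    (hgl1 : TrivialCharSplitLineFiniteAt K) : SplitPrimeLineSelmerFiniteAt W K :=
  hdev hred hgl1

/-- **First brick of DEV (kernel): the counting dévissage.**  If an additive map `f` has finite image on a subgroup `S`
and `S` meets `ker f` in a finite set, then `S` is finite (`|S| ≤ |f(S)|·|S ∩ ker f|`).  Applied to
`H¹(K_∞, 𝟙) → H¹(K_∞, E[2]) → H¹(K_∞, 𝟙)` with the BDP conditions. -/
theorem finite_of_finite_image_of_finite_inter_ker {B C : Type*} [AddCommGroup B] [AddCommGroup C] (f : B →+ C)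
    (S : AddSubgroup B) (himg : (f '' (S : Set B)).Finite) (hker : ((S : Set B) ∩ {b | f b = 0}).Finite) :
    (S : Set B).Finite := by
  have hsec : ∀ c ∈ f '' (S : Set B), ∃ s ∈ (S : Set B), f s = c := fun c hc ↦ by
    obtain ⟨s, hs, rfl⟩ := hc
    exact ⟨s, hs, rfl⟩
  choose! g hgS hgf using hsec
  have hsub : (S : Set B) ⊆
      (fun q : C × B ↦ g q.1 + q.2) '' ((f '' (S : Set B)) ×ˢ ((S : Set B) ∩ {b | f b = 0})) := by
    intro s hs
    have hfs : f s ∈ f '' (S : Set B) := ⟨s, hs, rfl⟩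
    refine ⟨(f s, s - g (f s)), ⟨hfs, ?_, ?_⟩, ?_⟩
    · exact S.sub_mem hs (hgS (f s) hfs)
    · show f (s - g (f s)) = 0
      rw [map_sub, hgf (f s) hfs, sub_self]
    · show g (f s) + (s - g (f s)) = s
      abel
  exact ((himg.prod hker).image _).subset hsub

/-! ## §5 How the node plugs into v6 (informational; the crux decl by name) -/

/-- The crux this line serves (O2, by name) — v7 of the line of record replaces the binder
`stub_lineFinite : TwoVariableLineSelmerFiniteAtTwo` of `bdpSelmerLowerDivisibilityAtTwo_of_katzSheet_of_lineFinite_of_acPin`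
by `TorsionResidueForallAt` (what its proof term uses), supplied by `torsionResidueForall_of_splitLine`. -/
example : Prop := Summit.BirchSwinnertonDyer.BirchSwinnertonDyer.Theorems.TwoAdicKatoDeterminant.BDPSelmerLowerDivisibilityAtTwo

end Summit.BirchSwinnertonDyer.BirchSwinnertonDyer.Cruxes.BDPSelmerLowerDivisibilityAtTwo.SplitPrimeLineFiniteTwo
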